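import Summits.Ventures.WeilGRH.TwistedCoshWindowTest
import Summits.Ventures.WeilGRH.TwistedFlatTestBounds
import Summits.RiemannHypothesis.RiemannHypothesis.Theorems.WeilFormatCWindowLimit
import HarnessLib

/-!
# GRH arm (rh-explicit, venture WeilGRH): the `cosh(x/2)` window with numbers — an explicit `e^a`-rate floor
  and `GRH(χ) ⟹` a non-trivial prime power below `x ≍ (log q)²`

Cell `rh-explicit`, WEIL TRACK (structure seat weil-3, gen7) for the GRH ARM.  Sequel of
`TwistedCoshWindowTest.lean` (the `cosh(x/2)`-window inequality and the Chebyshev lower bound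
`2Σ ≥ ψ(e^{2a−1})/2` for its trivial-key prime weight).  Here the archimedean energy is bounded for every
window function (`integral_weilArchDensityPar_mul_weilIncrement_le`:
`∫₀^∞ ρ_κ(t) D_t(u) dt ≤ 5(2aS₁² + 2S₀² + 8aS₀²)` from the format-C majorant `archBound` of
`WeilFormatCWindowLimit.lean`, `tρ₀(t) ≤ e^{-t/2}(1+2t)/2` and `∫₀^∞ e^{-t/2}(1+2t)/2 = 5`), hence:

* `cosh_exp_floor_le_log_of_weilPositivityOnChar_of_trivial`: for `a ≥ 1`, `WeilPositivityOnChar χ a` and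
  `χ(n) = 1` for all prime powers `n < e^{2a}` force **`(log 2/(2e))·e^a − 44a − 11 ≤ log q`** — the
  `e^a` RATE of the transfer constant `2(sinh a + a)` (the flat window gives `4e^a/a`);
* `exists_primePower_lt_chi_ne_one_of_grh_sq`: **`GRH(χ)`, `χ` primitive mod `q ≠ 1`, `x ≥ e²`,
  `log q < (log 2/(2e))√x − 22 log x − 11` ⟹ some prime power `n < x` has `χ(n) ≠ 1`** — the least
  character non-residue (or least prime dividing `q`) is `≪ (log q)²`, the Ankeny–Montgomery–Vaughan (Thm 13.11)
  SHAPE, reached here by Weil POSITIVITY at the pole-aligned window (constants not optimised: `62(log q + 22 log x + 11)²`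
  works).

No definitions, no named facts; RH/GRH-free except the `_of_grh` statements' hypothesis.
-/

set_option autoImplicit false

noncomputable section

open Complex Filter Set MeasureTheory
open scoped Real Topology ComplexConjugate ArithmeticFunction.vonMangoldt Chebyshev

namespace Summit.Ventures.WeilGRH

open Literature.NumberTheory.LFunctions
open Summit.RiemannHypothesis.RiemannHypothesis.Theorems.WeilFormatC

variable {q : ℕ} {a : ℝ}

/-! ## The archimedean energy of a window function is bounded -/

/-- **`∫₀^∞ ρ_κ(t) D_t(u) dt ≤ 5·(2aS₁² + 2S₀² + 8aS₀²)`** for every bounded measurable `u` vanishing off `[-a,a]`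
(`‖u‖ ≤ S₀`, `S₁`-Lipschitz on the closed window, `a ≥ 0`, any parity `κ`): the format-C majorant
(`D_t ≤ (2aS₁² + 2S₀²)t` on `(0,1]`, `≤ 8aS₀²` beyond) against `ρ_κ ≤ ρ₀`, `tρ₀(t) ≤ e^{-t/2}(1+2t)/2`. -/
theorem integral_weilArchDensityPar_mul_weilIncrement_le {u : ℝ → ℂ} {S₀ S₁ : ℝ} (ha : 0 ≤ a)
    (hm : Measurable u) (hz : ∀ x, x ∉ Icc (-a) a → u x = 0) (hb : ∀ x, ‖u x‖ ≤ S₀)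
    (hl : ∀ x y, x ∈ Icc (-a) a → y ∈ Icc (-a) a → ‖u y - u x‖ ≤ S₁ * |y - x|) (κ : ℕ) :
    ∫ t in Ioi (0 : ℝ), weilArchDensityPar κ t * weilIncrement u t ≤
      5 * (2 * a * S₁ ^ 2 + 2 * S₀ ^ 2 + 8 * a * S₀ ^ 2) := by
  set C : ℝ := 2 * a * S₁ ^ 2 + 2 * S₀ ^ 2 + 8 * a * S₀ ^ 2 with hC
  have hS₀ : 0 ≤ S₀ := (norm_nonneg _).trans (hb 0)
  have hC0 : 0 ≤ C := by positivity
  have hK : 2 * a * S₁ ^ 2 + 2 * S₀ ^ 2 ≤ C := by rw [hC]; nlinarith [sq_nonneg S₀]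
  have hB : 8 * a * S₀ ^ 2 ≤ C := by rw [hC]; nlinarith [sq_nonneg S₀, sq_nonneg S₁]
  have hmaj := integral_flatWindow_archMajorant
  calc ∫ t in Ioi (0 : ℝ), weilArchDensityPar κ t * weilIncrement u t
      ≤ ∫ t in Ioi (0 : ℝ), C * (Real.exp (-(1 / 2 * t)) * (1 + 2 * t) / 2) := by
        refine integral_mono_of_nonneg ?_ (integrableOn_flatWindow_archMajorant.const_mul C) ?_
        · refine (ae_restrict_iff' measurableSet_Ioi).2 (Eventually.of_forall fun t (ht : 0 < t) ↦ ?_)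
          exact mul_nonneg (weilArchDensityPar_nonneg_le κ ht).1 (weilIncrement_nonneg _ _)
        · refine (ae_restrict_iff' measurableSet_Ioi).2 (Eventually.of_forall fun t (ht : 0 < t) ↦ ?_)
          obtain ⟨h0, hle⟩ := weilArchDensityPar_nonneg_le κ ht
          have hD : 0 ≤ weilIncrement u t := weilIncrement_nonneg _ _
          have h1 : weilArchDensityPar κ t * weilIncrement u t ≤ weilArchDensity t * weilIncrement u t :=
            mul_le_mul_of_nonneg_right hle hD
          have h2 := weilArchDensity_mul_weilIncrement_le_archBound ha hm hz hb hl ht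
          have htρ := mul_weilArchDensity_le ht
          have hρ0 := (weilArchDensity_pos ht).le
          refine h1.trans (h2.trans ?_)
          split_ifs with h1'
          · -- `ρ₀ · K t ≤ K · (tρ₀) ≤ C · majorant`
            calc weilArchDensity t * ((2 * a * S₁ ^ 2 + 2 * S₀ ^ 2) * t)
                = (2 * a * S₁ ^ 2 + 2 * S₀ ^ 2) * (t * weilArchDensity t) := by ring
              _ ≤ C * (Real.exp (-(1 / 2 * t)) * (1 + 2 * t) / 2) :=
                mul_le_mul hK htρ (by positivity) hC0
          · -- `t > 1`: `ρ₀ ≤ t ρ₀ ≤ majorant`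
            have ht1 : 1 ≤ t := (not_le.1 h1').le
            have hρ : weilArchDensity t ≤ Real.exp (-(1 / 2 * t)) * (1 + 2 * t) / 2 :=
              le_trans (by nlinarith) htρ
            calc weilArchDensity t * (8 * a * S₀ ^ 2) = (8 * a * S₀ ^ 2) * weilArchDensity t := by ring
              _ ≤ C * (Real.exp (-(1 / 2 * t)) * (1 + 2 * t) / 2) := mul_le_mul hB hρ hρ0 hC0
    _ = 5 * C := by rw [integral_const_mul, hmaj, mul_comm]

/-- For the `cosh(x/2)` window: `∫₀^∞ ρ_κ D_t(cosh𝟙) ≤ (10 + 43a)·cosh²(a/2)` (`a ≥ 0`). -/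
theorem integral_arch_coshWindow_le (ha : 0 ≤ a) (κ : ℕ) :
    ∫ t in Ioi (0 : ℝ), weilArchDensityPar κ t *
        weilIncrement (fun x ↦ (((Icc (-a) a).indicator (fun y ↦ Real.cosh (y / 2)) x : ℝ) : ℂ)) t ≤
      (10 + 43 * a) * Real.cosh (a / 2) ^ 2 := by
  obtain ⟨hm, hz, hb, hL⟩ := coshWindow_window ha
  have hmu : Measurable fun x ↦ (((Icc (-a) a).indicator (fun y ↦ Real.cosh (y / 2)) x : ℝ) : ℂ) :=
    Complex.measurable_ofReal.comp hm
  have hzu : ∀ x, x ∉ Icc (-a) a → (((Icc (-a) a).indicator (fun y ↦ Real.cosh (y / 2)) x : ℝ) : ℂ) = 0 :=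
    fun x hx ↦ by rw [hz x hx, Complex.ofReal_zero]
  have hbu : ∀ x, ‖(((Icc (-a) a).indicator (fun y ↦ Real.cosh (y / 2)) x : ℝ) : ℂ)‖ ≤ Real.cosh (a / 2) :=
    fun x ↦ by rw [Complex.norm_real, Real.norm_eq_abs]; exact hb x
  have hlu : ∀ x y, x ∈ Icc (-a) a → y ∈ Icc (-a) a →
      ‖(((Icc (-a) a).indicator (fun y ↦ Real.cosh (y / 2)) y : ℝ) : ℂ) -
          (((Icc (-a) a).indicator (fun y ↦ Real.cosh (y / 2)) x : ℝ) : ℂ)‖ ≤ Real.sinh (a / 2) / 2 * |y - x| :=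
    fun x y hx hy ↦ by rw [← Complex.ofReal_sub, Complex.norm_real, Real.norm_eq_abs]; exact hL x y hx hy
  have h := integral_weilArchDensityPar_mul_weilIncrement_le ha hmu hzu hbu hlu κ
  have hsc : Real.sinh (a / 2) ^ 2 ≤ Real.cosh (a / 2) ^ 2 := by nlinarith [Real.cosh_sq (a / 2)]
  have hac : a * Real.sinh (a / 2) ^ 2 ≤ a * Real.cosh (a / 2) ^ 2 := mul_le_mul_of_nonneg_left hsc ha
  have hpos : 0 ≤ a * Real.cosh (a / 2) ^ 2 := mul_nonneg ha (sq_nonneg _)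
  have h' : 5 * (2 * a * (Real.sinh (a / 2) / 2) ^ 2 + 2 * Real.cosh (a / 2) ^ 2 +
      8 * a * Real.cosh (a / 2) ^ 2) =
      5 / 2 * (a * Real.sinh (a / 2) ^ 2) + 10 * Real.cosh (a / 2) ^ 2 + 40 * (a * Real.cosh (a / 2) ^ 2) := by
    ring
  have h'' : (10 + 43 * a) * Real.cosh (a / 2) ^ 2 = 10 * Real.cosh (a / 2) ^ 2 + 43 * (a * Real.cosh (a / 2) ^ 2) := by
    ring
  rw [h'']
  linarith

/-! ## The explicit `e^a`-rate floor for the trivial key -/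

/-- `cosh²(a/2) ≤ e^a` (`a ≥ 0`). -/
theorem cosh_half_sq_le_exp (ha : 0 ≤ a) : Real.cosh (a / 2) ^ 2 ≤ Real.exp a := by
  rw [Real.cosh_eq, div_pow, show Real.exp a = Real.exp (a / 2) * Real.exp (a / 2) by
    rw [← Real.exp_add]; ring_nf]
  have h1 : Real.exp (-(a / 2)) ≤ Real.exp (a / 2) := Real.exp_le_exp.2 (by linarith)
  have h0 : 0 < Real.exp (-(a / 2)) := Real.exp_pos _
  nlinarith

/-- `sinh a + a ≤ e^a` (`a ≥ 0`). -/
theorem sinh_add_self_le_exp (ha : 0 ≤ a) : Real.sinh a + a ≤ Real.exp a := by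
  have h1 : a ≤ Real.sinh a := Real.self_le_sinh_iff.2 ha
  have h2 : Real.sinh a < Real.cosh a := Real.sinh_lt_cosh a
  have h3 : Real.sinh a + Real.cosh a = Real.exp a := Real.sinh_add_cosh a
  linarith

/-- **THE `e^a`-RATE TRIVIAL-KEY FLOOR.**  For `a ≥ 1` and `χ` mod `q ≠ 1`: `WeilPositivityOnChar χ a` and
`χ(n) = 1` for every prime power `n < e^{2a}` force `(log 2/(2e))·e^a − 44a − 11 ≤ log q`.  RH/GRH-free. -/
theorem cosh_exp_floor_le_log_of_weilPositivityOnChar_of_trivial (hq : q ≠ 1) (χ : DirichletCharacter ℂ q)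
    (ha : 1 ≤ a) (hW : WeilPositivityOnChar χ a)
    (hkey : ∀ n ∈ weilPrimeIndex a, Λ n ≠ 0 → χ (n : ZMod q) = 1) :
    Real.log 2 / (2 * Real.exp 1) * Real.exp a - 44 * a - 11 ≤ Real.log q := by
  have ha0 : 0 < a := by linarith
  set N : ℝ := Real.sinh a + a with hN
  set X : ℝ := Real.exp (2 * a - 1) with hX
  have h := coshWindow_le_log_of_weilPositivityOnChar hq χ ha0 hW
  -- trivial key: the prime weight is the untwisted one
  have hs : ∑ n ∈ weilPrimeIndex a, (Λ n : ℝ) / Real.sqrt n * ((χ (n : ZMod q)).re *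
        (Real.sinh (a - Real.log n / 2) + (a - Real.log n / 2) * Real.cosh (Real.log n / 2))) =
      ∑ n ∈ weilPrimeIndex a, (Λ n : ℝ) / Real.sqrt n *
        (Real.sinh (a - Real.log n / 2) + (a - Real.log n / 2) * Real.cosh (Real.log n / 2)) := by
    refine Finset.sum_congr rfl fun n hn ↦ ?_
    by_cases hΛ : Λ n = 0
    · simp [hΛ]
    · rw [hkey n hn hΛ, Complex.one_re, one_mul]
  rw [hs] at h
  have hprime := psi_le_coshWindow_primeSum a
  have harch := integral_arch_coshWindow_le ha0.le (charParity χ)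
  have hK := flatWindow_const_ge χ
  have hN0 : 0 < N := by rw [hN]; have := Real.sinh_pos_iff.2 ha0; linarith
  have hNexp : N ≤ Real.exp a := sinh_add_self_le_exp ha0.le
  have hcosh := cosh_half_sq_le_exp ha0.le
  have hlogq : 0 ≤ Real.log q := Real.log_natCast_nonneg q
  -- `N log q ≥ ((X − 1) log 2 − log (X + 2))/2 − (10 + 43 a) e^a` (drop `K_κ N ≥ 0`)
  have hmain : ((X - 1) * Real.log 2 - Real.log (X + 2)) / 2 - (10 + 43 * a) * Real.exp a ≤
      Real.log q * N := by
    have h43 : (10 + 43 * a) * Real.cosh (a / 2) ^ 2 ≤ (10 + 43 * a) * Real.exp a :=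
      mul_le_mul_of_nonneg_left hcosh (by linarith)
    nlinarith [mul_nonneg (by linarith : (0:ℝ) ≤ 2.23) hN0.le]
  -- `log (X + 2) ≤ log 3 + 2a − 1 ≤ 2a + 1/5` (`3 < e^{6/5}`), `X·e = (e^a)²`
  have hX1 : 1 ≤ X := by rw [hX]; exact Real.one_le_exp (by linarith)
  have he := Real.exp_one_gt_d9
  have hlogX2 : Real.log (X + 2) ≤ 2 * a + 1 / 5 := by
    have h3 : (3 : ℝ) < Real.exp (6 / 5) := by
      rw [show (6 / 5 : ℝ) = 1 + 1 / 5 by norm_num, Real.exp_add]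
      have h15 : (1 / 5 : ℝ) + 1 ≤ Real.exp (1 / 5) := Real.add_one_le_exp _
      nlinarith [Real.exp_pos (1 / 5 : ℝ)]
    have hlog3 : Real.log 3 < 6 / 5 := by
      calc Real.log 3 < Real.log (Real.exp (6 / 5)) := Real.log_lt_log (by norm_num) h3
        _ = 6 / 5 := Real.log_exp _
    calc Real.log (X + 2) ≤ Real.log (3 * X) := Real.log_le_log (by linarith) (by linarith)
      _ = Real.log 3 + (2 * a - 1) := by rw [Real.log_mul (by norm_num) (by linarith), hX, Real.log_exp]
      _ ≤ 2 * a + 1 / 5 := by linarith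
  have hE2 : Real.exp a * Real.exp a = X * Real.exp 1 := by
    rw [hX, ← Real.exp_add, ← Real.exp_add]; congr 1; ring
  have hl2' := Real.log_two_lt_d9
  have hea : Real.exp 1 ≤ Real.exp a := Real.exp_le_exp.2 ha
  have hE0 : 0 < Real.exp a := Real.exp_pos a
  have hLX : 0 ≤ Real.log (X + 2) := Real.log_nonneg (by linarith)
  -- the floor `G` satisfies `G · e^a ≤ A ≤ log q · N ≤ log q · e^a`
  set G : ℝ := Real.log 2 / (2 * Real.exp 1) * Real.exp a - 44 * a - 11 with hG
  have hGE : G * Real.exp a = Real.log 2 * X / 2 - (44 * a + 11) * Real.exp a := by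
    have h1 : G * Real.exp a = Real.log 2 / (2 * Real.exp 1) * (Real.exp a * Real.exp a) -
        (44 * a + 11) * Real.exp a := by rw [hG]; ring
    rw [h1, hE2]
    field_simp
  have hprod : (a + 1) * Real.exp 1 ≤ (a + 1) * Real.exp a := mul_le_mul_of_nonneg_left hea (by linarith)
  have hprod' : (a + 1) * 2.7 ≤ (a + 1) * Real.exp 1 := mul_le_mul_of_nonneg_left (by linarith) (by linarith)
  have hAG : G * Real.exp a ≤ ((X - 1) * Real.log 2 - Real.log (X + 2)) / 2 - (10 + 43 * a) * Real.exp a := by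
    rw [hGE]
    nlinarith [hlogX2, hprod, hprod', hl2']
  by_cases hG0 : G ≤ 0
  · exact hG0.trans hlogq
  · push Not at hG0
    have h1 : G * Real.exp a ≤ Real.log q * Real.exp a :=
      (hAG.trans hmain).trans (mul_le_mul_of_nonneg_left hNexp hlogq)
    exact le_of_mul_le_mul_right h1 hE0

/-- Contrapositive: for `a ≥ 1`, a rung at `a` with `log q < (log 2/(2e))e^a − 44a − 11` NAMES a prime power
`n < e^{2a}` with `χ(n) ≠ 1`. -/
theorem exists_vonMangoldt_ne_zero_chi_ne_one_of_lt_cosh_floor (hq : q ≠ 1) (χ : DirichletCharacter ℂ q)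
    (ha : 1 ≤ a) (hW : WeilPositivityOnChar χ a)
    (hlt : Real.log q < Real.log 2 / (2 * Real.exp 1) * Real.exp a - 44 * a - 11) :
    ∃ n ∈ weilPrimeIndex a, Λ n ≠ 0 ∧ χ (n : ZMod q) ≠ 1 := by
  by_contra h
  push Not at h
  exact (not_le.2 hlt) (cosh_exp_floor_le_log_of_weilPositivityOnChar_of_trivial hq χ ha hW h)

/-- **`GRH(χ)` ⟹ a prime power `n < x` with `χ(n) ≠ 1` once `log q < (log 2/(2e))√x − 22 log x − 11`**
(`x ≥ e²`, `χ` primitive mod `q ≠ 1`): the least character non-residue of `χ` (or the least prime dividing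
`q`) is `≪ (log q)²` — the Ankeny / Montgomery–Vaughan Thm 13.11 shape — by Weil POSITIVITY at the `cosh(x/2)`
window of half-width `(log x)/2`. -/
theorem exists_primePower_lt_chi_ne_one_of_grh_sq [NeZero q] (hq : q ≠ 1) {χ : DirichletCharacter ℂ q}
    (hprim : χ.IsPrimitive) (hGRH : χ.RiemannHypothesis) {x : ℝ} (hx : Real.exp 2 ≤ x)
    (hlt : Real.log q < Real.log 2 / (2 * Real.exp 1) * Real.sqrt x - 22 * Real.log x - 11) :
    ∃ n : ℕ, (n : ℝ) < x ∧ Λ n ≠ 0 ∧ χ (n : ZMod q) ≠ 1 := by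
  have hx0 : 0 < x := (Real.exp_pos 2).trans_le hx
  set a : ℝ := Real.log x / 2 with ha
  have ha1 : 1 ≤ a := by
    rw [ha, le_div_iff₀ two_pos, ← Real.log_exp (1 * 2)]
    exact Real.log_le_log (Real.exp_pos _) (by norm_num; exact hx)
  have hW : WeilPositivityOnChar χ a := (WeilPositivityChar.of_grh hq hprim hGRH).on a
  have hexp : Real.exp a = Real.sqrt x := by
    symm
    rw [Real.sqrt_eq_iff_mul_self_eq_of_pos (Real.exp_pos _), ← Real.exp_add, ha, add_halves, Real.exp_log hx0]
  have hfloor : Real.log 2 / (2 * Real.exp 1) * Real.exp a - 44 * a - 11 =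
      Real.log 2 / (2 * Real.exp 1) * Real.sqrt x - 22 * Real.log x - 11 := by
    rw [hexp, ha]; ring
  rw [← hfloor] at hlt
  obtain ⟨n, hn, hΛ, hχn⟩ := exists_vonMangoldt_ne_zero_chi_ne_one_of_lt_cosh_floor hq χ ha1 hW hlt
  refine ⟨n, ?_, hΛ, hχn⟩
  have hlog : Real.log n < 2 * a := mem_weilPrimeIndex.1 hn
  rw [ha, mul_div_cancel₀ _ two_ne_zero] at hlog
  have hn0 : n ≠ 0 := by rintro rfl; simp at hΛ
  have hn1 : (0 : ℝ) < n := by exact_mod_cast Nat.pos_of_ne_zero hn0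
  exact (Real.log_lt_log_iff hn1 hx0).1 hlog

end Summit.Ventures.WeilGRH

end
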